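import Mathlib
import HarnessLib
import Summits.AtomisticToContinuum.FouriersLaw.Theses.JunctionLocality

/-!
# Junction dichotomy with rate (route JunctionLocality, item stmt-AtomisticToContinuum-11752)

Pure real analysis.  Let `D : ℕ → ℝ` with `D N > 0` for `N ≥ 2` and put `R N := (N - 1) / D N`
(the end-to-end resistance).  If `R` is two-sidedly approximately additive,
`|R (N + M) - R N - R M| ≤ C` for `N, M ≥ 2`, then EITHER there are `κ > 0` and `K` with
`|D N - κ| ≤ K / N` for all `N ≥ 2` (Fourier branch with the `1/N` finite-size rate), OR
`(N - 1) / C ≤ D N` for all `N ≥ 2` (ballistic branch: bounded resistance).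

Proof (sup-slope argument, no limits needed).  Iterating the two one-sided inequalities along
multiples gives `M · R N - (M-1) C ≤ R (M N) ≤ N · R M + (N-1) C`, hence the slope comparison
`(R N - C)/N ≤ (R M + C)/M` for all `N, M ≥ 2`.  With `ℓ := sup_N (R N - C)/N` this yields the
two-sided control `N ℓ - C ≤ R N ≤ N ℓ + C` for every `N ≥ 2`.  If `R N ≤ C` for all `N` we are
in the ballistic branch.  Otherwise `ℓ > 0`, `κ := 1/ℓ`, and
`|D N - κ| = |(N-1) ℓ - R N| / (R N ℓ) ≤ 2 (C + ℓ) / (ℓ² N)` as soon as `N ℓ > 2 C`; the finitely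
many smaller `N` are absorbed into the constant `K` by a finite sum.

Sources: the dichotomy is the route's own bookkeeping statement (Fekete/Hammersley-type
approximate additivity, Hammersley1988); no published theorem is cited as a hypothesis.
-/

namespace Summit.AtomisticToContinuum.FouriersLaw.Theorems

open Finset

/-- **Junction dichotomy with rate** (item stmt-AtomisticToContinuum-11752, route
JunctionLocality, support).  If `D N > 0` for `N ≥ 2` and the resistances `R N := (N-1)/D N`
satisfy two-sided locality `|R (N+M) - R N - R M| ≤ C` (`N, M ≥ 2`), then either
`∃ κ > 0, K, ∀ N ≥ 2, |D N - κ| ≤ K / N` or `∀ N ≥ 2, (N-1)/C ≤ D N`.  Proved by the sup-slope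
argument described in the module docstring. -/
theorem junctionDichotomy_proof :
    Summit.AtomisticToContinuum.FouriersLaw.Theses.JunctionLocality.JunctionDichotomy := by
  unfold Summit.AtomisticToContinuum.FouriersLaw.Theses.JunctionLocality.JunctionDichotomy
  intro D C hD hloc
  -- the resistance `R N = (N - 1) / D N`, kept opaque behind its defining equation
  obtain ⟨R, hR⟩ : ∃ R : ℕ → ℝ, ∀ N : ℕ, R N = ((N : ℝ) - 1) / D N :=
    ⟨fun N => ((N : ℝ) - 1) / D N, fun _ => rfl⟩
  have hRpos : ∀ N : ℕ, 2 ≤ N → 0 < R N := by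
    intro N hN
    have h2 : (2 : ℝ) ≤ (N : ℝ) := by exact_mod_cast hN
    rw [hR]
    exact div_pos (by linarith) (hD N hN)
  have hloc' : ∀ N M : ℕ, 2 ≤ N → 2 ≤ M → |R (N + M) - R N - R M| ≤ C := by
    intro N M hN hM
    simp only [hR, Nat.cast_add]
    exact hloc N M hN hM
  have hC0 : 0 ≤ C := le_trans (abs_nonneg _) (hloc' 2 2 le_rfl le_rfl)
  have hsup1 : ∀ N M : ℕ, 2 ≤ N → 2 ≤ M → R N + R M - C ≤ R (N + M) := by
    intro N M hN hM
    have h := (abs_le.mp (hloc' N M hN hM)).1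
    linarith
  have hsub1 : ∀ N M : ℕ, 2 ≤ N → 2 ≤ M → R (N + M) ≤ R N + R M + C := by
    intro N M hN hM
    have h := (abs_le.mp (hloc' N M hN hM)).2
    linarith
  -- iteration along multiples
  have hiter : ∀ N : ℕ, 2 ≤ N → ∀ M : ℕ, 1 ≤ M →
      (M : ℝ) * R N - ((M : ℝ) - 1) * C ≤ R (M * N) ∧
        R (M * N) ≤ (M : ℝ) * R N + ((M : ℝ) - 1) * C := by
    intro N hN M hM
    induction M, hM using Nat.le_induction with
    | base => simp
    | succ M hM ih =>
      have hMN : 2 ≤ M * N :=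
        calc 2 = 1 * 2 := by norm_num
          _ ≤ M * N := Nat.mul_le_mul hM hN
      have h1 := hsup1 (M * N) N hMN hN
      have h2 := hsub1 (M * N) N hMN hN
      have hmul : (M + 1) * N = M * N + N := by ring
      rw [hmul]
      push_cast
      constructor <;> linarith [ih.1, ih.2]
  -- slope comparison
  have hslope : ∀ N M : ℕ, 2 ≤ N → 2 ≤ M → (R N - C) / (N : ℝ) ≤ (R M + C) / (M : ℝ) := by
    intro N M hN hM
    have hN1 : 1 ≤ N := by omega
    have hM1 : 1 ≤ M := by omega
    have h1 := (hiter N hN M hM1).1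
    have h2 := (hiter M hM N hN1).2
    rw [Nat.mul_comm N M] at h2
    have hNpos : (0 : ℝ) < N := by exact_mod_cast (by omega : 0 < N)
    have hMpos : (0 : ℝ) < M := by exact_mod_cast (by omega : 0 < M)
    rw [div_le_div_iff₀ hNpos hMpos]
    linarith
  by_cases hcase : ∀ N : ℕ, 2 ≤ N → R N ≤ C
  · -- ballistic branch: bounded resistance
    right
    intro N hN
    have hCpos : 0 < C := lt_of_lt_of_le (hRpos 2 le_rfl) (hcase 2 le_rfl)
    have h1 : R N ≤ C := hcase N hN
    rw [hR, div_le_iff₀ (hD N hN)] at h1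
    rw [div_le_iff₀ hCpos]
    linarith
  · -- Fourier branch with rate
    left
    push Not at hcase
    obtain ⟨N₀, hN₀, hN₀C⟩ := hcase
    haveI : Nonempty {N : ℕ // 2 ≤ N} := ⟨⟨2, le_rfl⟩⟩
    let f : {N : ℕ // 2 ≤ N} → ℝ := fun N => (R N.1 - C) / (N.1 : ℝ)
    have hbdd : BddAbove (Set.range f) := by
      refine ⟨(R 2 + C) / ((2 : ℕ) : ℝ), ?_⟩
      rintro x ⟨N, rfl⟩
      exact hslope N.1 2 N.2 le_rfl
    obtain ⟨ℓ, hℓ⟩ : ∃ ℓ : ℝ, ℓ = ⨆ N, f N := ⟨_, rfl⟩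
    have hup : ∀ N : ℕ, 2 ≤ N → (R N - C) / (N : ℝ) ≤ ℓ := by
      intro N hN
      rw [hℓ]
      exact le_ciSup hbdd ⟨N, hN⟩
    have hlow : ∀ M : ℕ, 2 ≤ M → ℓ ≤ (R M + C) / (M : ℝ) := by
      intro M hM
      rw [hℓ]
      exact ciSup_le fun N => hslope N.1 M N.2 hM
    have hℓpos : 0 < ℓ := by
      have h1 := hup N₀ hN₀
      have hN₀pos : (0 : ℝ) < N₀ := by exact_mod_cast (by omega : 0 < N₀)
      have h2 : 0 < (R N₀ - C) / (N₀ : ℝ) := div_pos (by linarith) hN₀pos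
      linarith
    have hRup : ∀ N : ℕ, 2 ≤ N → R N ≤ (N : ℝ) * ℓ + C := by
      intro N hN
      have hNpos : (0 : ℝ) < N := by exact_mod_cast (by omega : 0 < N)
      have h := hup N hN
      rw [div_le_iff₀ hNpos] at h
      linarith
    have hRlow : ∀ N : ℕ, 2 ≤ N → (N : ℝ) * ℓ - C ≤ R N := by
      intro N hN
      have hNpos : (0 : ℝ) < N := by exact_mod_cast (by omega : 0 < N)
      have h := hlow N hN
      rw [le_div_iff₀ hNpos] at h
      linarith
    -- threshold beyond which `N ℓ > 2 C`
    obtain ⟨N₁, hN₁⟩ := exists_nat_ge (2 * C / ℓ)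
    have hsum_nonneg :
        0 ≤ ∑ i ∈ Finset.range (N₁ + 1), (i : ℝ) * |D i - 1 / ℓ| :=
      Finset.sum_nonneg fun i _ => mul_nonneg (Nat.cast_nonneg i) (abs_nonneg _)
    have hA_nonneg : 0 ≤ 2 * (C + ℓ) / ℓ ^ 2 := div_nonneg (by linarith) (sq_nonneg ℓ)
    refine ⟨1 / ℓ, 2 * (C + ℓ) / ℓ ^ 2 + ∑ i ∈ Finset.range (N₁ + 1), (i : ℝ) * |D i - 1 / ℓ|,
      div_pos one_pos hℓpos, ?_⟩
    intro N hN
    have hNpos : (0 : ℝ) < N := by exact_mod_cast (by omega : 0 < N)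
    rw [le_div_iff₀ hNpos]
    rcases le_or_gt N N₁ with hle | hlt
    · -- finitely many small `N`: absorbed into the finite sum
      have hmem : N ∈ Finset.range (N₁ + 1) := Finset.mem_range.mpr (by omega)
      have hsingle : (N : ℝ) * |D N - 1 / ℓ| ≤
          ∑ i ∈ Finset.range (N₁ + 1), (i : ℝ) * |D i - 1 / ℓ| :=
        Finset.single_le_sum (f := fun i : ℕ => (i : ℝ) * |D i - 1 / ℓ|)
          (fun i _ => mul_nonneg (Nat.cast_nonneg _) (abs_nonneg _)) hmem
      calc |D N - 1 / ℓ| * (N : ℝ) = (N : ℝ) * |D N - 1 / ℓ| := by ring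
        _ ≤ ∑ i ∈ Finset.range (N₁ + 1), (i : ℝ) * |D i - 1 / ℓ| := hsingle
        _ ≤ _ := by linarith
    · -- large `N`: the analytic `1/N` bound
      have hNℓ : 2 * C < (N : ℝ) * ℓ := by
        have h1 : 2 * C / ℓ < (N : ℝ) := lt_of_le_of_lt hN₁ (by exact_mod_cast hlt)
        rwa [div_lt_iff₀ hℓpos] at h1
      have hrpos : 0 < R N := hRpos N hN
      have hr : (N : ℝ) * ℓ ≤ 2 * R N := by linarith [hRlow N hN]
      have hd : D N = ((N : ℝ) - 1) / R N := by
        rw [eq_div_iff hrpos.ne', hR, mul_div_assoc', mul_div_cancel_left₀ _ (hD N hN).ne']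
      have hkey : |D N - 1 / ℓ| = |((N : ℝ) - 1) * ℓ - R N| / (R N * ℓ) := by
        rw [hd, div_sub_div _ _ hrpos.ne' hℓpos.ne', mul_one, abs_div,
          abs_of_pos (mul_pos hrpos hℓpos)]
      have hnum : |((N : ℝ) - 1) * ℓ - R N| ≤ C + ℓ := by
        rw [abs_le]
        constructor <;> linarith [hRup N hN, hRlow N hN, hℓpos]
      have hmain : |D N - 1 / ℓ| * (N : ℝ) ≤ 2 * (C + ℓ) / ℓ ^ 2 := by
        rw [hkey, div_mul_eq_mul_div,
          div_le_div_iff₀ (mul_pos hrpos hℓpos) (pow_pos hℓpos 2)]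
        have h1 : |((N : ℝ) - 1) * ℓ - R N| * ((N : ℝ) * ℓ) ≤ (C + ℓ) * (2 * R N) :=
          mul_le_mul hnum hr (by positivity) (by linarith)
        have h2 := mul_le_mul_of_nonneg_right h1 hℓpos.le
        calc |((N : ℝ) - 1) * ℓ - R N| * (N : ℝ) * ℓ ^ 2
            = |((N : ℝ) - 1) * ℓ - R N| * ((N : ℝ) * ℓ) * ℓ := by ring
          _ ≤ (C + ℓ) * (2 * R N) * ℓ := h2
          _ = 2 * (C + ℓ) * (R N * ℓ) := by ring
      linarith [hmain, hsum_nonneg]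

end Summit.AtomisticToContinuum.FouriersLaw.Theorems
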